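import Summits.QuantumFields.BalabanUV.Beta.GAN24.Push4Locality

/-!
# `BalabanUV.Beta.GAN24.Push4LocalityRecord` — binder row G-an2-4 ∕ (CONV-C), W-slot road «W3»: THE ROW OWNER's STATEMENT OF RECORD for (F3-core-a)
# (`HOME/b2b-balaban-gan24-p1/W3-F3-core-a.STATEMENT.lean` 32ed7227bf731056, journal l.8133; SKELETON-W3 v1.0.2 §8.6) — VERBATIM, as a corollary of
# `Push4Locality.push₄_locStencil₂` (p211973)

NOT IN PRINT; OUR PROOF ATTEMPT (G-an2-4 formalisation swarm, leaf prover `b2b-balaban-gan24-formalise-leaf-03`, gen 17; journal INTENT «W3-TMARG-CORE*» l.7823).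
HONEST FRAMING (cell contract, verbatim): «discharging `BetaPertH` makes Bałaban's UV stability UNCONDITIONAL — a real constructive-QFT result; it is NOT the
continuum limit and NOT the Clay problem.»  HONEST DEPENDENCY (verbatim): «continuum YM on T⁴ ⇐ BetaPertH ∧ nine spine estimates (0/9 proved); BetaPertH ⇐ (D1) ∧
(D4) ∧ CAP+tail; G-an2-4 gates asym, D1 and NE2/3/4.»

WHAT.  **`exists_push₄_locStencil₂_const`** — the owner's cut, token for token (binder order `K₄` BEFORE `L ∕ l ∕ r ∕ A ∕ X ∕ C`, the leg envelopes in leaf-12's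
`RespStepDecay` currency `A·((L:ℝ)^(d+2))⁻¹·e^{−κ₀‖quo L · − ·‖∞}`, output constant `K₄·A⁴·C·(L^{d+1}·((L^{d+2})⁻¹)⁴)`, output rate `κ₀/(6(d+1))`, hypotheses
`0 < κ₀ < δ`): with the EXPLICIT `K₄ := (d+1)^4·Zl_{d+1}(δ/2)^3·Zl_{d+1}(κ₀/(d+1)/4)` of `Push4Locality.push₄_locStencil₂`, whose rate `min (κ₀/(d+1)/4) (δ/2)` dominates
`κ₀/(6(d+1))` when `κ₀ < δ` (`BalabanCompositeJets.LocStencil₂.mono`).  [folklore] bookkeeping; 0 def, 0 cite, 0 sorry.  NOT ROW W3-F3a (the chain `transport (lin4 …) = c^k • push₄ (composite legs)`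
+ the first general step (R14-7) + the arithmetic `|c|^k·L^{−3d−7} = |ĉ|^k·Lc^{k(d−3)}` under hpin remain the row holder's); NOT (T-irr); discharges NOTHING of «T2Shape»∕«T2SupRate»∕(hW, hWall);
0∕2 wall binders; NOT «W-slot closed», NEVER «G-an2-4 closed»; NOT BetaPertH, NOT continuum, NOT Clay.
-/

noncomputable section

open Literature.MathematicalPhysics.QuantumFieldTheory
open Literature.MathematicalPhysics.QuantumFieldTheory.Balaban1983to89
open Literature.MathematicalPhysics.QuantumFieldTheory.Balaban1983to89.Beta
open B12Sec2to5 (l1)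
open B4ContourShift (supNorm)
open LatticeForm (quo)
open ExpKernelCalculus (MKer BiLoc Zl Zl_nonneg)
open OneStepResolventKernel (Fib)
open BalabanCompositeJets (LocStencil₂)
open Summit.QuantumFields.BalabanUV.Beta.GAN24.Push4 (push₄)
open Summit.QuantumFields.BalabanUV.Beta.GAN24.Push4Locality (push₄_locStencil₂)

namespace Summit.QuantumFields.BalabanUV.Beta.GAN24.Push4LocalityRecord

variable {d : ℕ}

/-- NOT IN PRINT; OUR PROOF.  **(F3-core-a) THE FOUR-LEG MASS BOUND — THE ROW OWNER's STATEMENT OF RECORD** (SKELETON-W3 §8.6; `W3-F3-core-a.STATEMENT.lean`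
32ed7227bf731056 with its `sorry` replaced): legs with the `RespStepDecay` envelope at RELATIVE blocking `L` push a `LocStencil₂` table at the fine level to a
`LocStencil₂` table at the coarse level, constant `K₄·A⁴·C·L^{d+1}·(L^{d+2})⁻⁴` with ONE `K₄ = K₄(d, δ, κ₀) ≥ 0` chosen BEFORE `L`, the legs, `A`, the table and `C`,
rate `κ₀/(6(d+1))` — `Push4Locality.push₄_locStencil₂` with `K₄ := (d+1)^4·Zl(δ/2)^3·Zl(κ₀/(d+1)/4)` and the rate weakened from `min (κ₀/(d+1)/4) (δ/2)`. -/
theorem exists_push₄_locStencil₂_const {δ κ₀ : ℝ} (hκ₀ : 0 < κ₀) (hδ : κ₀ < δ) :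
    ∃ K₄ : ℝ, 0 ≤ K₄ ∧ ∀ (L : ℕ), 1 ≤ L →
      ∀ (l r : Fin (d + 1) → (Fin (d + 1) → ℤ) → Fin (d + 1) → (Fin (d + 1) → ℤ) → ℝ) (A : ℝ),
        (∀ α x' κ x, |l α x' κ x| ≤ A * (((L : ℕ) : ℝ) ^ (d + 2))⁻¹ * Real.exp (-(κ₀ * supNorm (quo L x - x')))) →
        (∀ μ y κ u, |r μ y κ u| ≤ A * (((L : ℕ) : ℝ) ^ (d + 2))⁻¹ * Real.exp (-(κ₀ * supNorm (quo L u - y)))) →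
        ∀ (X : Fin (d + 1) → (Fin (d + 1) → ℤ) → Fin (d + 1) → (Fin (d + 1) → ℤ) → MKer (d + 1) (Fib d)) (C : ℝ),
          LocStencil₂ X C δ →
          LocStencil₂ (push₄ l r X) (K₄ * A ^ 4 * C * ((L : ℝ) ^ (d + 1) * ((((L : ℕ) : ℝ) ^ (d + 2))⁻¹) ^ 4)) (κ₀ / (6 * (d + 1))) := by
  have hδ0 : 0 < δ := hκ₀.trans hδ
  have hd : (0 : ℝ) < (d : ℝ) + 1 := by positivity
  refine ⟨((d + 1 : ℕ) : ℝ) ^ 4 * Zl (d + 1) (δ / 2) ^ 3 * Zl (d + 1) (κ₀ / ((d : ℝ) + 1) / 4), ?_, fun L hL l r A hl hr X C hX => ?_⟩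
  · have h1 : 0 ≤ Zl (d + 1) (δ / 2) := Zl_nonneg (by linarith)
    have h2 : 0 ≤ Zl (d + 1) (κ₀ / ((d : ℝ) + 1) / 4) := Zl_nonneg (by positivity)
    positivity
  have h := push₄_locStencil₂ (X := X) hL hδ0 hκ₀ hl hr hX
  have hrate : κ₀ / (6 * ((d : ℝ) + 1)) ≤ min (κ₀ / ((d : ℝ) + 1) / 4) (δ / 2) := by
    refine le_min ?_ ?_
    · rw [div_div, div_le_div_iff_of_pos_left hκ₀ (by positivity) (by positivity)]
      linarith
    · rw [div_le_iff₀ (by positivity)]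
      nlinarith
  have h' := h.mono hrate
  have hK : (((d + 1 : ℕ) : ℝ) ^ 4 * Zl (d + 1) (δ / 2) ^ 3 * Zl (d + 1) (κ₀ / ((d : ℝ) + 1) / 4)) * A ^ 4 * C * (L : ℝ) ^ (d + 1)
        * (((L : ℝ) ^ (d + 2))⁻¹) ^ 4
      = ((d + 1 : ℕ) : ℝ) ^ 4 * Zl (d + 1) (δ / 2) ^ 3 * Zl (d + 1) (κ₀ / ((d : ℝ) + 1) / 4) * A ^ 4 * C
        * ((L : ℝ) ^ (d + 1) * ((((L : ℕ) : ℝ) ^ (d + 2))⁻¹) ^ 4) := by push_cast; ring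
  rw [hK] at h'
  exact h'

end Summit.QuantumFields.BalabanUV.Beta.GAN24.Push4LocalityRecord

end
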